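import Summits.CriticalPhenomena.PercolationContinuityZ3.Theorems.Transplant.GrigorchukPowerNcHaraSladeDefs
import Literature.Probability.Percolation.SharpnessQuasiTransitive
import HarnessLib

/-!
# W4 — the LAZY random-walk kernel of DEFS-A as a positive operator: support, Chapman–Kolmogorov, symmetry on regular graphs, and positive
# semidefiniteness of every power `P_L^n` as a quadratic form (item E4.3, file a: the generic walk side of `TraceMonotonicity`)

Proof file (`--supports stmt-CriticalPhenomena-4575 --as helper`), lane `prim-bschramm`, seat `prim-bschramm-gen-1` gen 12 (GEN pen); item E4.3 of the lead's
allocation (lead g29, bus 2026-08-29 #9800; W4 skeleton of record, stub `stub_traceMonotonicity`), FILE a of three (generic; b = ball matrices, c = assembly), over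
DEFS-A «GrigorchukPowerNcHaraSladeDefs» (`lazyStep`) and the ball finsets `DCTQ.ball` of «SharpnessQuasiTransitive».  builds on p205010 (kernel theorem, internal audit
signed; external expert review pending) — nothing here uses p205010.  Def-free; no instance, no notation, no sorry, no `@[conjecture]`; nothing about `θ(p_c)`, OIRB
or the triangle condition — pure random-walk kernel algebra on a locally finite (resp. `d`-regular) graph.

CONTENT (namespace `…Transplant.Grigorchuk.NcHaraSlade`, any locally finite `G`; `p^L_n = lazyStep G n`).  §1 `lazyStep_nonneg`; `lazyStep_eq_zero_of_notMem_ball` (the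
`n`-step kernel from `x` is supported in `B(x, n)`).  §2 CHAPMAN–KOLMOGOROV `lazyStep_add`: `p^L_{m+n}(x, z) = Σ_{y ∈ S} p^L_m(x, y)·p^L_n(y, z)` for every finset
`S ⊇ B(x, m)`, and the restricted-sum inequality `sum_lazyStep_mul_le`.  §3 On a `d`-REGULAR graph: the right recursion `lazyStep_succ_right` (`P_L` commutes with its
powers) and the SYMMETRY `lazyStep_comm : p^L_n(x, y) = p^L_n(y, x)`.  §4 POSITIVITY of every power as a quadratic form on finitely supported functions:
`lazyStep_one_quadratic_nonneg` (`⟨g, P_L g⟩ = ½‖g‖² + (1/2d) Σ_{w ∼ w'} g(w)g(w') ≥ 0`, by `(g(w) + g(w'))² ≥ 0` summed over the edges), and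
**`lazyStep_quadratic_nonneg (n) (S) (f) : 0 ≤ Σ_{x,y ∈ S} f(x) f(y) p^L_n(x, y)`** (`P_L^{2m} = P_L^m P_L^m`, `P_L^{2m+1} = P_L^m P_L P_L^m` by §2–§3); whence the
two-point consequence `lazyStep_le_half_add : p^L_n(x, y) ≤ (p^L_n(x,x) + p^L_n(y,y))/2`.  §5 Automorphism invariance `lazyStep_iso` (`p^L_n(φ x, φ y) = p^L_n(x, y)`).
[cite: Woess2000, §1.B (transition operator, reversibility)] [cite: HeydenreichVanDerHofstad2017, §5.2 (random-walk quantities)]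
-/

noncomputable section

namespace Summit.CriticalPhenomena.PercolationContinuityZ3.Theorems.Transplant

namespace Grigorchuk

namespace NcHaraSlade

open SimpleGraph Finset Literature.Probability.Percolation

variable {V : Type} [DecidableEq V] (G : SimpleGraph V) [G.LocallyFinite]

/-! ## §1 Nonnegativity and support -/

/-- `0 ≤ p^L_n(x, y)`. [cite: Woess2000, §1.B] -/
theorem lazyStep_nonneg (n : ℕ) (x y : V) : 0 ≤ lazyStep G n x y := by
  induction n generalizing x with
  | zero => rw [lazyStep_zero]; split_ifs <;> norm_num
  | succ n ih =>
    rw [lazyStep_succ]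
    exact add_nonneg (mul_nonneg (by norm_num) (ih x))
      (mul_nonneg (by norm_num) (Finset.sum_nonneg fun z _ => mul_nonneg (by positivity) (ih z)))

/-- **The `n`-step lazy kernel from `x` is supported in the ball `B(x, n)`**. [cite: Woess2000, §1.B] -/
theorem lazyStep_eq_zero_of_notMem_ball {n : ℕ} {x y : V} (hy : y ∉ DCTQ.ball G x n) : lazyStep G n x y = 0 := by
  induction n generalizing x with
  | zero =>
    rw [DCTQ.ball_zero, Finset.mem_singleton] at hy
    rw [lazyStep_zero, if_neg (Ne.symm hy)]
  | succ n ih =>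
    rw [lazyStep_succ, ih (fun h => hy (DCTQ.subset_ball_succ x n h)), mul_zero, zero_add]
    refine mul_eq_zero_of_right _ (Finset.sum_eq_zero fun z hz => ?_)
    rw [ih (fun h => hy ?_), mul_zero]
    have hz1 : z ∈ DCTQ.ball G x 1 := DCTQ.mem_ball_succ_of_adj (DCTQ.mem_ball_self x 0) ((G.mem_neighborFinset x z).1 hz)
    have := DCTQ.mem_ball_add hz1 h
    rwa [add_comm] at this

/-! ## §2 Chapman–Kolmogorov -/

/-- **Chapman–Kolmogorov for the lazy kernel**: `p^L_{m+n}(x, z) = Σ_{y ∈ S} p^L_m(x, y)·p^L_n(y, z)` for every finset `S ⊇ B(x, m)` (the `m`-step kernel from `x`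
vanishes off `B(x, m)`). [cite: Woess2000, §1.B (P^{m+n} = P^m P^n)] -/
theorem lazyStep_add (m n : ℕ) (x z : V) (S : Finset V) (hS : DCTQ.ball G x m ⊆ S) :
    lazyStep G (m + n) x z = ∑ y ∈ S, lazyStep G m x y * lazyStep G n y z := by
  induction m generalizing x S with
  | zero =>
    have hx : x ∈ S := hS (DCTQ.mem_ball_self x 0)
    rw [zero_add]
    simp only [lazyStep_zero, ite_mul, one_mul, zero_mul]
    rw [Finset.sum_ite_eq S x, if_pos hx]
  | succ m ih =>
    rw [show m + 1 + n = (m + n) + 1 by omega, lazyStep_succ]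
    have hxS : DCTQ.ball G x m ⊆ S := (DCTQ.subset_ball_succ x m).trans hS
    have hwS : ∀ w ∈ G.neighborFinset x, DCTQ.ball G w m ⊆ S := by
      intro w hw y hy
      have hw1 : w ∈ DCTQ.ball G x 1 := DCTQ.mem_ball_succ_of_adj (DCTQ.mem_ball_self x 0) ((G.mem_neighborFinset x w).1 hw)
      have := DCTQ.mem_ball_add hw1 hy
      rw [add_comm] at this
      exact hS this
    have hN : ∑ w ∈ G.neighborFinset x, 1 / (G.degree x : ℝ) * lazyStep G (m + n) w z =
        ∑ w ∈ G.neighborFinset x, 1 / (G.degree x : ℝ) * ∑ y ∈ S, lazyStep G m w y * lazyStep G n y z :=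
      Finset.sum_congr rfl fun w hw => by rw [ih w S (hwS w hw)]
    rw [ih x S hxS, hN]
    -- RHS: expand `p^L_{m+1}(x, y)` and rearrange
    have hR : ∀ y ∈ S, lazyStep G (m + 1) x y * lazyStep G n y z =
        (1 / 2 : ℝ) * (lazyStep G m x y * lazyStep G n y z) +
          (1 / 2 : ℝ) * ∑ w ∈ G.neighborFinset x, 1 / (G.degree x : ℝ) * (lazyStep G m w y * lazyStep G n y z) := by
      intro y _
      rw [lazyStep_succ, add_mul, Finset.mul_sum, Finset.mul_sum, Finset.sum_mul]
      congr 1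
      · ring
      · exact Finset.sum_congr rfl fun w _ => by ring
    have hRHS : ∑ y ∈ S, lazyStep G (m + 1) x y * lazyStep G n y z =
        (1 / 2 : ℝ) * ∑ y ∈ S, lazyStep G m x y * lazyStep G n y z +
          (1 / 2 : ℝ) * ∑ y ∈ S, ∑ w ∈ G.neighborFinset x, 1 / (G.degree x : ℝ) * (lazyStep G m w y * lazyStep G n y z) := by
      rw [Finset.sum_congr rfl hR, Finset.sum_add_distrib, Finset.mul_sum, Finset.mul_sum]
    rw [hRHS]
    congr 2
    calc ∑ w ∈ G.neighborFinset x, 1 / (G.degree x : ℝ) * ∑ y ∈ S, lazyStep G m w y * lazyStep G n y z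
        = ∑ w ∈ G.neighborFinset x, ∑ y ∈ S, 1 / (G.degree x : ℝ) * (lazyStep G m w y * lazyStep G n y z) :=
          Finset.sum_congr rfl fun w _ => Finset.mul_sum S (fun y => lazyStep G m w y * lazyStep G n y z) (1 / (G.degree x : ℝ))
      _ = _ := Finset.sum_comm

/-- **Restricting the middle point loses mass**: `Σ_{y ∈ T} p^L_m(x, y)·p^L_n(y, z) ≤ p^L_{m+n}(x, z)` for every finset `T` (nonnegative terms).
[cite: Woess2000, §1.B] -/
theorem sum_lazyStep_mul_le (m n : ℕ) (x z : V) (T : Finset V) :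
    ∑ y ∈ T, lazyStep G m x y * lazyStep G n y z ≤ lazyStep G (m + n) x z := by
  rw [lazyStep_add G m n x z (T ∪ DCTQ.ball G x m) Finset.subset_union_right]
  exact Finset.sum_le_sum_of_subset_of_nonneg Finset.subset_union_left fun y _ _ =>
    mul_nonneg (lazyStep_nonneg G m x y) (lazyStep_nonneg G n y z)

/-! ## §3 Regular graphs: the right recursion and symmetry -/

/-- **The right recursion on a `d`-regular graph** (`P_L` commutes with its powers): `p^L_{n+1}(x, y) = ½ p^L_n(x, y) + ½ Σ_{z ∼ y} d⁻¹ p^L_n(x, z)`.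
[cite: Woess2000, §1.B (P^{n+1} = P^n P)] -/
theorem lazyStep_succ_right {d : ℕ} (hG : G.IsRegularOfDegree d) (n : ℕ) (x y : V) :
    lazyStep G (n + 1) x y = (1 / 2 : ℝ) * lazyStep G n x y + (1 / 2 : ℝ) * ∑ z ∈ G.neighborFinset y, (1 / (d : ℝ)) * lazyStep G n x z := by
  induction n generalizing x y with
  | zero =>
    -- `Σ_{z ∼ x} d⁻¹ [z = y] = d⁻¹ [y ∼ x] = d⁻¹ [x ∼ y] = Σ_{z ∼ y} d⁻¹ [x = z]`
    have hsum : ∀ a b : V, ∑ z ∈ G.neighborFinset a, (1 / (d : ℝ)) * lazyStep G 0 z b = if b ∈ G.neighborFinset a then 1 / (d : ℝ) else 0 := by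
      intro a b
      by_cases hb : b ∈ G.neighborFinset a
      · rw [if_pos hb, Finset.sum_eq_single_of_mem b hb (fun z _ hz => by rw [lazyStep_zero, if_neg hz, mul_zero]), lazyStep_zero,
          if_pos rfl, mul_one]
      · rw [if_neg hb]
        exact Finset.sum_eq_zero fun z hz => by rw [lazyStep_zero, if_neg (fun h : z = b => hb (h ▸ hz)), mul_zero]
    have hsum' : ∀ a b : V, ∑ z ∈ G.neighborFinset b, (1 / (d : ℝ)) * lazyStep G 0 a z = if a ∈ G.neighborFinset b then 1 / (d : ℝ) else 0 := by
      intro a b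
      by_cases ha : a ∈ G.neighborFinset b
      · rw [if_pos ha, Finset.sum_eq_single_of_mem a ha (fun z _ hz => by rw [lazyStep_zero, if_neg (Ne.symm hz), mul_zero]), lazyStep_zero,
          if_pos rfl, mul_one]
      · rw [if_neg ha]
        exact Finset.sum_eq_zero fun z hz => by rw [lazyStep_zero, if_neg (fun h : a = z => ha (h ▸ hz)), mul_zero]
    rw [lazyStep_succ, hG x, hsum x y, hsum' x y]
    have hiff : y ∈ G.neighborFinset x ↔ x ∈ G.neighborFinset y := by
      rw [SimpleGraph.mem_neighborFinset, SimpleGraph.mem_neighborFinset]; exact ⟨fun h => h.symm, fun h => h.symm⟩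
    by_cases h : y ∈ G.neighborFinset x
    · rw [if_pos h, if_pos (hiff.1 h)]
    · rw [if_neg h, if_neg (fun h' => h (hiff.2 h'))]
  | succ n ih =>
    -- commutation at level `n`: `Σ_{w ∼ x} d⁻¹ p^L_n(w, y) = Σ_{z ∼ y} d⁻¹ p^L_n(x, z)` (left recursion vs. the induction hypothesis)
    have hcomm : ∀ a b : V, ∑ w ∈ G.neighborFinset a, (1 / (d : ℝ)) * lazyStep G n w b = ∑ z ∈ G.neighborFinset b, (1 / (d : ℝ)) * lazyStep G n a z := by
      intro a b
      have h1 := ih a b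
      have h2 : lazyStep G (n + 1) a b = (1 / 2 : ℝ) * lazyStep G n a b +
          (1 / 2 : ℝ) * ∑ w ∈ G.neighborFinset a, (1 / (G.degree a : ℝ)) * lazyStep G n w b := lazyStep_succ G n a b
      rw [hG a] at h2
      linarith
    set P₁ : ℝ := ∑ w ∈ G.neighborFinset x, (1 / (d : ℝ)) * lazyStep G n w y with hP₁
    set P₂ : ℝ := ∑ z ∈ G.neighborFinset y, (1 / (d : ℝ)) * lazyStep G n x z with hP₂
    set Q₁ : ℝ := ∑ w ∈ G.neighborFinset x, (1 / (d : ℝ)) * ∑ z ∈ G.neighborFinset y, (1 / (d : ℝ)) * lazyStep G n w z with hQ₁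
    set Q₂ : ℝ := ∑ z ∈ G.neighborFinset y, (1 / (d : ℝ)) * ∑ w ∈ G.neighborFinset x, (1 / (d : ℝ)) * lazyStep G n w z with hQ₂
    have hP : P₁ = P₂ := hcomm x y
    have hQ : Q₁ = Q₂ := by
      have e1 : Q₁ = ∑ w ∈ G.neighborFinset x, ∑ z ∈ G.neighborFinset y, (1 / (d : ℝ)) * ((1 / (d : ℝ)) * lazyStep G n w z) :=
        Finset.sum_congr rfl fun w _ => Finset.mul_sum _ _ _
      have e2 : Q₂ = ∑ z ∈ G.neighborFinset y, ∑ w ∈ G.neighborFinset x, (1 / (d : ℝ)) * ((1 / (d : ℝ)) * lazyStep G n w z) :=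
        Finset.sum_congr rfl fun z _ => Finset.mul_sum _ _ _
      rw [e1, e2, Finset.sum_comm]
    have hL : ∑ w ∈ G.neighborFinset x, (1 / (d : ℝ)) * lazyStep G (n + 1) w y = (1 / 2 : ℝ) * P₁ + (1 / 2 : ℝ) * Q₁ := by
      have e : ∀ w ∈ G.neighborFinset x, (1 / (d : ℝ)) * lazyStep G (n + 1) w y =
          (1 / 2 : ℝ) * ((1 / (d : ℝ)) * lazyStep G n w y) +
            (1 / 2 : ℝ) * ((1 / (d : ℝ)) * ∑ z ∈ G.neighborFinset y, (1 / (d : ℝ)) * lazyStep G n w z) := fun w _ => by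
        rw [ih w y]; ring
      rw [Finset.sum_congr rfl e, Finset.sum_add_distrib, hP₁, hQ₁, Finset.mul_sum, Finset.mul_sum]
    have hR : ∑ z ∈ G.neighborFinset y, (1 / (d : ℝ)) * lazyStep G (n + 1) x z = (1 / 2 : ℝ) * P₂ + (1 / 2 : ℝ) * Q₂ := by
      have e : ∀ z ∈ G.neighborFinset y, (1 / (d : ℝ)) * lazyStep G (n + 1) x z =
          (1 / 2 : ℝ) * ((1 / (d : ℝ)) * lazyStep G n x z) +
            (1 / 2 : ℝ) * ((1 / (d : ℝ)) * ∑ w ∈ G.neighborFinset x, (1 / (d : ℝ)) * lazyStep G n w z) := fun z _ => by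
        rw [lazyStep_succ, hG x]; ring
      rw [Finset.sum_congr rfl e, Finset.sum_add_distrib, hP₂, hQ₂, Finset.mul_sum, Finset.mul_sum]
    rw [lazyStep_succ, hG x, hL, hR, hP, hQ]

/-- **SYMMETRY of the lazy kernel on a regular graph**: `p^L_n(x, y) = p^L_n(y, x)` (reversibility w.r.t. the counting measure). [cite: Woess2000, §1.B (reversibility)] -/
theorem lazyStep_comm {d : ℕ} (hG : G.IsRegularOfDegree d) (n : ℕ) (x y : V) : lazyStep G n x y = lazyStep G n y x := by
  induction n generalizing x y with
  | zero => simp only [lazyStep_zero]; by_cases h : x = y <;> simp [h, eq_comm]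
  | succ n ih =>
    rw [lazyStep_succ_right G hG n x y, lazyStep_succ, hG y, ih x y]
    congr 2
    exact Finset.sum_congr rfl fun z _ => by rw [ih x z]

/-! ## §4 Positivity of `P_L` and of its powers as quadratic forms -/

/-- **`⟨g, P_L g⟩ ≥ 0` on a `d`-regular graph**: writing `p^L_1(x, y) = ½[x = y] + (1/2d)[y ∼ x]`,
`Σ_{x,y ∈ S} g(x) g(y) p^L_1(x, y) = ½ Σ g² + (1/2d) Σ_{x,y ∈ S, x ∼ y} g(x) g(y) ≥ 0`, because `Σ_{x,y ∈ S, x ∼ y} (g(x) + g(y))² ≥ 0` and every vertex has at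
most `d` neighbours in `S`. [cite: Woess2000, §1.B (P_L = (I+P)/2)] -/
theorem lazyStep_one_quadratic_nonneg {d : ℕ} (hG : G.IsRegularOfDegree d) (S : Finset V) (g : V → ℝ) :
    0 ≤ ∑ x ∈ S, ∑ y ∈ S, g x * g y * lazyStep G 1 x y := by
  -- `p^L_1(x, y) = ½ [x = y] + (1/2d) [y ∼ x]`
  have hsum : ∀ a b : V, ∑ z ∈ G.neighborFinset a, (1 / (d : ℝ)) * lazyStep G 0 z b = if b ∈ G.neighborFinset a then 1 / (d : ℝ) else 0 := by
    intro a b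
    by_cases hb : b ∈ G.neighborFinset a
    · rw [if_pos hb, Finset.sum_eq_single_of_mem b hb (fun z _ hz => by rw [lazyStep_zero, if_neg hz, mul_zero]), lazyStep_zero,
        if_pos rfl, mul_one]
    · rw [if_neg hb]
      exact Finset.sum_eq_zero fun z hz => by rw [lazyStep_zero, if_neg (fun h : z = b => hb (h ▸ hz)), mul_zero]
  have h1 : ∀ x y, lazyStep G 1 x y = (1 / 2 : ℝ) * (if x = y then 1 else 0) +
      (1 / (2 * (d : ℝ))) * (if y ∈ G.neighborFinset x then 1 else 0) := by
    intro x y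
    change lazyStep G (0 + 1) x y = _
    rw [lazyStep_succ, hG x, hsum x y, lazyStep_zero]
    split_ifs <;> ring
  -- the sums: diagonal `D`, adjacency `A`, neighbour counts `N₁`, `N₂`
  set D : ℝ := ∑ x ∈ S, g x ^ 2 with hD
  set A : ℝ := ∑ x ∈ S, ∑ y ∈ S, (if y ∈ G.neighborFinset x then g x * g y else 0) with hA
  set N₁ : ℝ := ∑ x ∈ S, ∑ y ∈ S, (if y ∈ G.neighborFinset x then g x ^ 2 else 0) with hN₁
  set N₂ : ℝ := ∑ x ∈ S, ∑ y ∈ S, (if y ∈ G.neighborFinset x then g y ^ 2 else 0) with hN₂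
  have hQ : ∑ x ∈ S, ∑ y ∈ S, g x * g y * lazyStep G 1 x y = (1 / 2 : ℝ) * D + (1 / (2 * (d : ℝ))) * A := by
    have hxy : ∀ x ∈ S, ∑ y ∈ S, g x * g y * lazyStep G 1 x y =
        (1 / 2 : ℝ) * g x ^ 2 + (1 / (2 * (d : ℝ))) * ∑ y ∈ S, (if y ∈ G.neighborFinset x then g x * g y else 0) := by
      intro x hx
      have e : ∀ y, g x * g y * lazyStep G 1 x y =
          (1 / 2 : ℝ) * (if x = y then g x * g y else 0) + (1 / (2 * (d : ℝ))) * (if y ∈ G.neighborFinset x then g x * g y else 0) := by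
        intro y; rw [h1]; split_ifs <;> ring
      rw [Finset.sum_congr rfl fun y _ => e y, Finset.sum_add_distrib, ← Finset.mul_sum, ← Finset.mul_sum, Finset.sum_ite_eq S x, if_pos hx]
      ring
    rw [Finset.sum_congr rfl hxy, Finset.sum_add_distrib, ← Finset.mul_sum, ← Finset.mul_sum]
  -- neighbour counts: at most `d` neighbours inside `S`
  have hcount : ∀ x : V, ((S.filter fun y => y ∈ G.neighborFinset x).card : ℝ) ≤ (d : ℝ) := by
    intro x
    have h : (S.filter fun y => y ∈ G.neighborFinset x).card ≤ (G.neighborFinset x).card :=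
      Finset.card_le_card fun y hy => (Finset.mem_filter.1 hy).2
    rw [card_neighborFinset_eq_degree, hG x] at h
    exact_mod_cast h
  have hN₁le : N₁ ≤ (d : ℝ) * D := by
    rw [hN₁, hD, Finset.mul_sum]
    refine Finset.sum_le_sum fun x _ => ?_
    rw [← Finset.sum_filter, Finset.sum_const, nsmul_eq_mul]
    exact mul_le_mul_of_nonneg_right (hcount x) (sq_nonneg _)
  have hN₂le : N₂ ≤ (d : ℝ) * D := by
    rw [hN₂, Finset.sum_comm, hD, Finset.mul_sum]
    refine Finset.sum_le_sum fun y _ => ?_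
    have e : ∑ x ∈ S, (if y ∈ G.neighborFinset x then g y ^ 2 else 0) = ∑ x ∈ S.filter (fun x => x ∈ G.neighborFinset y), g y ^ 2 := by
      rw [Finset.sum_filter]
      refine Finset.sum_congr rfl fun x _ => ?_
      have hiff : y ∈ G.neighborFinset x ↔ x ∈ G.neighborFinset y := by
        rw [SimpleGraph.mem_neighborFinset, SimpleGraph.mem_neighborFinset]; exact ⟨fun h => h.symm, fun h => h.symm⟩
      by_cases h : y ∈ G.neighborFinset x
      · rw [if_pos h, if_pos (hiff.1 h)]
      · rw [if_neg h, if_neg (fun h' => h (hiff.2 h'))]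
    rw [e, Finset.sum_const, nsmul_eq_mul]
    exact mul_le_mul_of_nonneg_right (hcount y) (sq_nonneg _)
  -- `Σ_{x,y ∈ S, y ∼ x} (g x + g y)² = N₁ + N₂ + 2A ≥ 0`
  have hsq : 0 ≤ N₁ + N₂ + 2 * A := by
    have h : N₁ + N₂ + 2 * A = ∑ x ∈ S, ∑ y ∈ S, (if y ∈ G.neighborFinset x then (g x + g y) ^ 2 else 0) := by
      rw [hN₁, hN₂, hA, Finset.mul_sum, ← Finset.sum_add_distrib, ← Finset.sum_add_distrib]
      refine Finset.sum_congr rfl fun x _ => ?_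
      rw [Finset.mul_sum, ← Finset.sum_add_distrib, ← Finset.sum_add_distrib]
      refine Finset.sum_congr rfl fun y _ => ?_
      split_ifs <;> ring
    rw [h]
    exact Finset.sum_nonneg fun x _ => Finset.sum_nonneg fun y _ => by split_ifs <;> positivity
  rw [hQ]
  have hD0 : 0 ≤ D := Finset.sum_nonneg fun x _ => sq_nonneg _
  have hA' : -((d : ℝ) * D) ≤ A := by linarith
  rcases Nat.eq_zero_or_pos d with rfl | hd
  · -- no edges: the off-diagonal coefficient `1/(2·0)` vanishes
    simp only [Nat.cast_zero, mul_zero, div_zero, zero_mul, add_zero]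
    positivity
  have hdpos : (0 : ℝ) < (d : ℝ) := by exact_mod_cast hd
  have hkey : (1 / 2 : ℝ) * D + 1 / (2 * (d : ℝ)) * (-((d : ℝ) * D)) = 0 := by field_simp; ring
  calc (0 : ℝ) = (1 / 2 : ℝ) * D + 1 / (2 * (d : ℝ)) * (-((d : ℝ) * D)) := hkey.symm
    _ ≤ (1 / 2 : ℝ) * D + 1 / (2 * (d : ℝ)) * A := by gcongr

/-- **Every power `P_L^n` is positive semidefinite as a quadratic form** on a `d`-regular graph: `0 ≤ Σ_{x,y ∈ S} f(x) f(y) p^L_n(x, y)` for every finset `S`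
and every `f` — `P_L^{2m} = (P_L^m)ᵀ P_L^m` and `P_L^{2m+1} = (P_L^m)ᵀ P_L P_L^m` by Chapman–Kolmogorov and symmetry, then `lazyStep_one_quadratic_nonneg`.
[cite: Woess2000, §1.B (reversibility, positivity of the lazy operator)] -/
theorem lazyStep_quadratic_nonneg {d : ℕ} (hG : G.IsRegularOfDegree d) (n : ℕ) (S : Finset V) (f : V → ℝ) :
    0 ≤ ∑ x ∈ S, ∑ y ∈ S, f x * f y * lazyStep G n x y := by
  obtain ⟨m, hm | hm⟩ : ∃ m, n = m + m ∨ n = m + (m + 1) := ⟨n / 2, by omega⟩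
  all_goals
    -- a finset `W` containing every ball `B(x, m)`, `x ∈ S`
    set W : Finset V := S.biUnion fun x => DCTQ.ball G x m with hW
    have hWS : ∀ x ∈ S, DCTQ.ball G x m ⊆ W := fun x hx y hy => Finset.mem_biUnion.2 ⟨x, hx, hy⟩
  · -- even power: `Σ f f p^L_{2m} = Σ_w h(w)²` with `h(w) = Σ_x f(x) p^L_m(x, w)`
    have hck : ∀ x ∈ S, ∀ y ∈ S, f x * f y * lazyStep G n x y =
        ∑ w ∈ W, (f x * lazyStep G m x w) * (f y * lazyStep G m y w) := by
      intro x hx y _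
      rw [hm, lazyStep_add G m m x y W (hWS x hx), Finset.mul_sum]
      exact Finset.sum_congr rfl fun w _ => by rw [lazyStep_comm G hG m w y]; ring
    calc (0 : ℝ) ≤ ∑ w ∈ W, (∑ x ∈ S, f x * lazyStep G m x w) ^ 2 := Finset.sum_nonneg fun w _ => sq_nonneg _
      _ = ∑ w ∈ W, ∑ x ∈ S, ∑ y ∈ S, (f x * lazyStep G m x w) * (f y * lazyStep G m y w) :=
          Finset.sum_congr rfl fun w _ => by rw [sq, Finset.sum_mul_sum]
      _ = ∑ x ∈ S, ∑ y ∈ S, f x * f y * lazyStep G n x y := by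
          rw [Finset.sum_comm]
          refine Finset.sum_congr rfl fun x hx => ?_
          rw [Finset.sum_comm]
          exact Finset.sum_congr rfl fun y hy => (hck x hx y hy).symm
  · -- odd power: `Σ f f p^L_{2m+1} = ⟨h, P_L h⟩`
    have hck : ∀ x ∈ S, ∀ y ∈ S, f x * f y * lazyStep G n x y =
        ∑ w ∈ W, ∑ w' ∈ W, (f x * lazyStep G m x w) * (f y * lazyStep G m y w') * lazyStep G 1 w w' := by
      intro x hx y hy
      calc f x * f y * lazyStep G n x y
          = f x * f y * ∑ w ∈ W, lazyStep G m x w * lazyStep G (m + 1) w y := by rw [hm, lazyStep_add G m (m + 1) x y W (hWS x hx)]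
        _ = ∑ w ∈ W, f x * f y * (lazyStep G m x w * lazyStep G (m + 1) w y) := Finset.mul_sum _ _ _
        _ = ∑ w ∈ W, ∑ w' ∈ W, (f x * lazyStep G m x w) * (f y * lazyStep G m y w') * lazyStep G 1 w w' := by
            refine Finset.sum_congr rfl fun w _ => ?_
            -- `p^L_{m+1}(w, y) = p^L_{m+1}(y, w) = Σ_{w'} p^L_m(y, w') p^L_1(w', w)` (symmetry; `B(y, m) ⊆ W`)
            rw [lazyStep_comm G hG (m + 1) w y, lazyStep_add G m 1 y w W (hWS y hy), Finset.mul_sum, Finset.mul_sum]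
            exact Finset.sum_congr rfl fun w' _ => by rw [lazyStep_comm G hG 1 w' w]; ring
    have hpos := lazyStep_one_quadratic_nonneg G hG W (fun w => ∑ x ∈ S, f x * lazyStep G m x w)
    calc (0 : ℝ) ≤ ∑ w ∈ W, ∑ w' ∈ W, (∑ x ∈ S, f x * lazyStep G m x w) * (∑ y ∈ S, f y * lazyStep G m y w') * lazyStep G 1 w w' := hpos
      _ = ∑ w ∈ W, ∑ w' ∈ W, ∑ x ∈ S, ∑ y ∈ S, (f x * lazyStep G m x w) * (f y * lazyStep G m y w') * lazyStep G 1 w w' := by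
          refine Finset.sum_congr rfl fun w _ => Finset.sum_congr rfl fun w' _ => ?_
          rw [Finset.sum_mul_sum, Finset.sum_mul]
          exact Finset.sum_congr rfl fun x _ => by rw [Finset.sum_mul]
      _ = ∑ x ∈ S, ∑ y ∈ S, f x * f y * lazyStep G n x y := by
          -- move the `x, y` sums outside
          rw [Finset.sum_comm]
          refine (Finset.sum_congr rfl fun w _ => Finset.sum_comm).trans ?_
          rw [Finset.sum_comm]
          refine Finset.sum_congr rfl fun x hx => ?_
          rw [Finset.sum_comm]
          refine (Finset.sum_congr rfl fun w _ => Finset.sum_comm).trans ?_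
          rw [Finset.sum_comm]
          exact Finset.sum_congr rfl fun y hy => (hck x hx y hy).symm

/-- **The two-point consequence of positivity**: `p^L_n(x, y) ≤ (p^L_n(x, x) + p^L_n(y, y))/2` on a `d`-regular graph — the quadratic form at
`f = δ_x − δ_y`, with the symmetry of `p^L_n`. [cite: Woess2000, §1.B] -/
theorem lazyStep_le_half_add {d : ℕ} (hG : G.IsRegularOfDegree d) (n : ℕ) (x y : V) :
    lazyStep G n x y ≤ (lazyStep G n x x + lazyStep G n y y) / 2 := by
  by_cases hxy : x = y
  · subst hxy; linarith
  have h := lazyStep_quadratic_nonneg G hG n ({x, y} : Finset V) (fun z => if z = x then 1 else -1)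
  rw [Finset.sum_pair hxy, Finset.sum_pair hxy, Finset.sum_pair hxy] at h
  have hyx : ¬ y = x := fun e => hxy e.symm
  simp only [if_true, hyx, if_false] at h
  rw [lazyStep_comm G hG n y x] at h
  linarith

end NcHaraSlade

end Grigorchuk

end Summit.CriticalPhenomena.PercolationContinuityZ3.Theorems.Transplant

end
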